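import Summits.CriticalPhenomena.PercolationContinuityZ3.Theses.PercNonProliferation
import Summits.CriticalPhenomena.PercolationContinuityZ3.Theorems.NonProliferation.Negative.AboveSix
import Summits.CriticalPhenomena.PercolationContinuityZ3.Theorems.PercNonProliferationNonProliferationStubCellUnionBound
import Summits.CriticalPhenomena.PercolationContinuityZ3.Theorems.PercNonProliferationNonProliferationStubBoundaryGrid
import HarnessLib

/-!
# Crux `PercNonProliferation.NonProliferation` (stmt-CriticalPhenomena-4444), line `boundary-pinning` —
# calibration: the line's open stub is dimension-sensitive (its `d`-dimensional analogue fails above six)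

Lead's calibration file for line `boundary-pinning` (payload slug `Sketch`,
prover-line-stmt-CriticalPhenomena-4444-c1; skeleton `Cruxes/NonProliferation/Lines/boundary_pinning.lean`).
Lands with `--supports stmt-CriticalPhenomena-4444`; closes nothing.

The line's single open stub `stub_boundaryCellTwoArm` asks, at `p_c(ℤ³)`, that the boundary
two-DISTINCT-cluster event of a cell `Q ⊆ ∂ⁱⁿB(2n)` of coordinate-diameter `≤ εn` have probability
`o(ε²) = o(1/#cells)`. Its `d`-dimensional analogue replaces `ε²` by `ε^{d-1}` (the free boundary of
`B(2n) ⊆ ℤ^d` is `(d-1)`-dimensional). The bookkeeping of the line (grid `stub_boundaryGrid`, pigeonhole and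
union bound `stub_cellUnionBound`, both landed and valid in EVERY dimension) turns the `d`-dimensional analogue
into the `d`-dimensional crux (`nonProliferationDim_of_boundaryCellTwoArmDim`); since the latter is FALSE for
every `d ≥ 7` under Aizenman's two-point condition (t-c) with `η = 0`
(`Negative.nonProliferation_false_of_twoPointBoundedRatio`, from the proved barrier `SpanningClustersAboveSix`),
so is the analogue of the stub (`boundaryCellTwoArmDim_false_above_six`). Hence any proof of the open stub must
use an input specific to low dimension, exactly as `Negative.nonProliferation_false_without_dimThree` demands of
every sufficient condition for the crux: the stub, not the bookkeeping, carries the `d = 3` content of the line.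
-/

noncomputable section

namespace Summit.CriticalPhenomena.PercolationContinuityZ3.Theorems.NonProliferation

open MeasureTheory Filter Topology
open Literature.Probability.LatticeModels Literature.Probability.Percolation
open Literature.Barriers.CriticalPhenomena
open Summit.CriticalPhenomena.PercolationContinuityZ3.Theorems.NonProliferation.Negative

namespace BoundaryPinningCalibration

/-- Arithmetic of the mesh in dimension `d`: if `ε ≤ 1`, `2 ≤ ε n` and `s = ⌊ε n⌋`, then
`2d (4n/s + 2)^{d-1} ≤ 2d·10^{d-1} / ε^{d-1}` (the shape produced by `stub_boundaryGrid` at `R = 2n`). -/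
theorem grid_count_le_dim (d : ℕ) {ε : ℝ} {n s : ℕ} (hε0 : 0 < ε) (hε1 : ε ≤ 1) (hn : 2 ≤ ε * n)
    (hs : s = ⌊ε * n⌋₊) :
    2 * (d : ℝ) * (2 * ((2 * n : ℕ) : ℝ) / s + 2) ^ (d - 1) ≤ 2 * d * 10 ^ (d - 1) / ε ^ (d - 1) := by
  have hs_gt : ε * n - 1 < s := by rw [hs]; exact Nat.sub_one_lt_floor (ε * n)
  have hs_ge : ε * n / 2 ≤ s := by linarith
  have hs_pos : (0 : ℝ) < s := by linarith
  have h1 : 2 * ((2 * n : ℕ) : ℝ) / s ≤ 8 / ε := by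
    rw [div_le_div_iff₀ hs_pos hε0]
    push_cast
    nlinarith
  have h2 : 2 * ((2 * n : ℕ) : ℝ) / s + 2 ≤ 10 / ε := by
    have h3 : (2 : ℝ) ≤ 2 / ε := by
      rw [le_div_iff₀ hε0]; nlinarith
    have h4 : 8 / ε + 2 / ε = 10 / ε := by ring
    linarith
  have h0 : (0 : ℝ) ≤ 2 * ((2 * n : ℕ) : ℝ) / s + 2 := by positivity
  calc 2 * (d : ℝ) * (2 * ((2 * n : ℕ) : ℝ) / s + 2) ^ (d - 1)
      ≤ 2 * (d : ℝ) * (10 / ε) ^ (d - 1) := by gcongr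
    _ = 2 * d * 10 ^ (d - 1) / ε ^ (d - 1) := by rw [div_pow]; ring

end BoundaryPinningCalibration

/-- **The dimension-free bookkeeping of line `boundary-pinning`, in every `d`.** If for every `δ > 0` there is
a mesh `ε ∈ (0,1]` such that, for infinitely many `n`, every cell `Q ⊆ ∂ⁱⁿB(2n)` of coordinate-diameter `≤ εn`
carries the boundary two-distinct-cluster event with `P_{p_c(ℤ^d)}`-probability `≤ δ ε^{d-1}`, then the
`d`-dimensional crux `∃ M c, 0 < c ∧ ∃ᶠ n, c ≤ P_{p_c(ℤ^d)}((repEvent d M n)ᶜ)` holds (grid `stub_boundaryGrid`,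
pigeonhole/union bound `stub_cellUnionBound`; `δ := 1/(2K+2)`, `K := 2d·10^{d-1}`, `M := ⌊K/ε^{d-1}⌋`,
`c = 1/2`). At `d = 3` the hypothesis is the line's open stub verbatim. -/
theorem nonProliferationDim_of_boundaryCellTwoArmDim :
    ∀ d : ℕ, (∀ δ : ℝ, 0 < δ → ∃ ε : ℝ, 0 < ε ∧ ε ≤ 1 ∧ ∃ᶠ n : ℕ in atTop,
      ∀ Q : Finset (Site d), Q ⊆ innerBoundary (zdGraph d) (box d (2 * n)) →
        (∀ u ∈ Q, ∀ v ∈ Q, ∀ i : Fin d, ((|u i - v i| : ℤ) : ℝ) ≤ ε * n) →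
        (bondPercolation (zdGraph d) (criticalProbI d)).real
          {ω | ∃ u ∈ Q, ∃ v ∈ Q, (∃ a ∈ box d n, ω ∈ openConnIn (↑(box d (2 * n)) : Set (Site d)) u a) ∧
            (∃ b ∈ box d n, ω ∈ openConnIn (↑(box d (2 * n)) : Set (Site d)) v b) ∧
            ω ∉ openConnIn (↑(box d (2 * n)) : Set (Site d)) u v} ≤ δ * ε ^ (d - 1)) →
    ∃ (M : ℕ) (c : ℝ), 0 < c ∧ ∃ᶠ n : ℕ in atTop,
      c ≤ (bondPercolation (zdGraph d) (criticalProbI d)).real (repEvent d M n)ᶜ := by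
  intro d h
  set μ : Measure (BondConfig (Site d)) := bondPercolation (zdGraph d) (criticalProbI d) with hμ
  set K : ℝ := 2 * d * 10 ^ (d - 1) with hK
  have hK0 : 0 ≤ K := by positivity
  have hδ0 : (0 : ℝ) < 1 / (2 * K + 2) := by positivity
  obtain ⟨ε, hε0, hε1, hfreq⟩ := h (1 / (2 * K + 2)) hδ0
  have hεp : 0 < ε ^ (d - 1) := pow_pos hε0 _
  refine ⟨⌊K / ε ^ (d - 1)⌋₊, 1 / 2, by norm_num, ?_⟩
  have hev : ∀ᶠ n : ℕ in atTop, 2 ≤ ε * n := by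
    refine (eventually_ge_atTop ⌈2 / ε⌉₊).mono fun n hn => ?_
    have h' : 2 / ε ≤ n := (Nat.le_ceil _).trans (by exact_mod_cast hn)
    rwa [div_le_iff₀ hε0, mul_comm] at h'
  refine (hfreq.and_eventually hev).mono fun n hn => ?_
  obtain ⟨hQ, hn2⟩ := hn
  set s : ℕ := ⌊ε * n⌋₊ with hs
  have hs1 : 1 ≤ s := by
    rw [hs, Nat.one_le_floor_iff]; linarith
  obtain ⟨𝒬, hsub, hdiam, -, hcov, hcount⟩ := stub_boundaryGrid d (2 * n) s hs1
  have hs_le : (s : ℝ) ≤ ε * n := Nat.floor_le (by positivity)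
  have hcell : ∀ Q ∈ 𝒬, μ.real
      {ω | ∃ u ∈ Q, ∃ v ∈ Q, (∃ a ∈ box d n, ω ∈ openConnIn (↑(box d (2 * n)) : Set (Site d)) u a) ∧
        (∃ b ∈ box d n, ω ∈ openConnIn (↑(box d (2 * n)) : Set (Site d)) v b) ∧
        ω ∉ openConnIn (↑(box d (2 * n)) : Set (Site d)) u v} ≤ 1 / (2 * K + 2) * ε ^ (d - 1) := by
    intro Q hQ𝒬
    refine hQ Q (hsub Q hQ𝒬) fun u hu v hv i => ?_
    have h := hdiam Q hQ𝒬 u hu v hv i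
    have h' : ((|u i - v i| : ℤ) : ℝ) + 1 ≤ s := by exact_mod_cast h
    linarith
  have hcountK : (𝒬.card : ℝ) ≤ K / ε ^ (d - 1) :=
    hcount.trans (BoundaryPinningCalibration.grid_count_le_dim d hε0 hε1 hn2 hs)
  have hunion : μ.real (repEvent d 𝒬.card n) ≤ 1 / 2 := by
    calc μ.real (repEvent d 𝒬.card n)
        ≤ ∑ Q ∈ 𝒬, μ.real
            {ω | ∃ u ∈ Q, ∃ v ∈ Q, (∃ a ∈ box d n, ω ∈ openConnIn (↑(box d (2 * n)) : Set (Site d)) u a) ∧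
              (∃ b ∈ box d n, ω ∈ openConnIn (↑(box d (2 * n)) : Set (Site d)) v b) ∧
              ω ∉ openConnIn (↑(box d (2 * n)) : Set (Site d)) u v} :=
          stub_cellUnionBound d n (criticalProbI d) 𝒬 hcov
      _ ≤ ∑ Q ∈ 𝒬, 1 / (2 * K + 2) * ε ^ (d - 1) := Finset.sum_le_sum hcell
      _ = 𝒬.card * (1 / (2 * K + 2) * ε ^ (d - 1)) := by rw [Finset.sum_const, nsmul_eq_mul]
      _ ≤ K / ε ^ (d - 1) * (1 / (2 * K + 2) * ε ^ (d - 1)) := by gcongr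
      _ = K / (2 * K + 2) := by field_simp
      _ ≤ 1 / 2 := by
          rw [div_le_iff₀ (by positivity)]; linarith
  have hM : 𝒬.card ≤ ⌊K / ε ^ (d - 1)⌋₊ := Nat.le_floor hcountK
  have hmono : μ.real (repEvent d ⌊K / ε ^ (d - 1)⌋₊ n) ≤ μ.real (repEvent d 𝒬.card n) :=
    measureReal_mono (repEvent_antitone d n hM) (measure_ne_top _ _)
  rw [probReal_compl_eq_one_sub (measurableSet_repEvent d _ n)]
  linarith

/-- **Calibration: the open stub of line `boundary-pinning` fails above six dimensions.** For every `d ≥ 7`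
satisfying Aizenman's two-point condition (t-c) with `η = 0` (`TwoPointBoundedRatio d`), the `d`-dimensional
analogue of `stub_boundaryCellTwoArm` (cell decay `o(ε^{d-1})`) is FALSE: otherwise the dimension-free
bookkeeping would give the `d`-dimensional crux, refuted by
`Negative.nonProliferation_false_of_twoPointBoundedRatio` (annulus-spanning box-clusters proliferate above
six dimensions, Aizenman 1997 Thm 4(3), proved barrier `SpanningClustersAboveSix`). -/
theorem boundaryCellTwoArmDim_false_above_six {d : ℕ} [NeZero d] (hd : 6 < d)
    (hτ : TwoPointBoundedRatio d) :
    ¬ ∀ δ : ℝ, 0 < δ → ∃ ε : ℝ, 0 < ε ∧ ε ≤ 1 ∧ ∃ᶠ n : ℕ in atTop,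
      ∀ Q : Finset (Site d), Q ⊆ innerBoundary (zdGraph d) (box d (2 * n)) →
        (∀ u ∈ Q, ∀ v ∈ Q, ∀ i : Fin d, ((|u i - v i| : ℤ) : ℝ) ≤ ε * n) →
        (bondPercolation (zdGraph d) (criticalProbI d)).real
          {ω | ∃ u ∈ Q, ∃ v ∈ Q, (∃ a ∈ box d n, ω ∈ openConnIn (↑(box d (2 * n)) : Set (Site d)) u a) ∧
            (∃ b ∈ box d n, ω ∈ openConnIn (↑(box d (2 * n)) : Set (Site d)) v b) ∧
            ω ∉ openConnIn (↑(box d (2 * n)) : Set (Site d)) u v} ≤ δ * ε ^ (d - 1) :=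
  fun h => nonProliferation_false_of_twoPointBoundedRatio hd hτ
    (nonProliferationDim_of_boundaryCellTwoArmDim d h)

end Summit.CriticalPhenomena.PercolationContinuityZ3.Theorems.NonProliferation

end
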